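import Literature.Geometry.Riemannian.ConjugateHeatGradientEstimate
import Literature.Geometry.Riemannian.HeatKernelFnUpperBound
import Literature.Geometry.Riemannian.HeatKernelGaussianIntegralBound
import Literature.Geometry.Riemannian.HeatKernelBootstrapBallAux
import Literature.Geometry.Riemannian.CanonicalNeighbourhoodsProofs
import Literature.Geometry.Riemannian.KernelNashEntropy
import HarnessLib

/-!
# The a-priori (flow-dependent) Gaussian upper bound for the heat kernel of a Ricci flow on a
# closed manifold, centred at an `H_m`-centre (Bamler 2020a, §7.2, (7.17)–(7.19))

R. Bamler, *Entropy and heat kernel bounds on a Ricci flow background*, arXiv:2008.07093 (2020a),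
§7.2, proof of Thm. 7.2, displays (7.17)–(7.19): "there is a constant `C* < ∞`, which may depend
on the geometry of the flow, such that `K(x,t;y,s) ≤ C* (t−s)^{-n/2} exp(−d_s²(z,y)/(C*(t−s)))`
whenever `(z, s)` is an `H_n`-centre of `(x, t)`" — the qualitative Gaussian bound which starts
the bootstrap of Thm. 7.2 (there imported from Chow et al., Part III, Thm. 26.25).

This file PROVES this bound (`exists_apriori_heatKernelFn_le_gaussian`) for a Ricci flow
`(h, cov)` on `[a, T]` of a `C^∞` family of Riemannian metrics on a closed connected manifold
`M` modelled on `ℝᵐ`, `m ≥ 3`, a fixed earlier time `s ∈ (a, T)`, bounded curvature `|Rm| ≤ Λ`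
and `|∇R|² ≤ Λ'²` on `[s, T]`: there are `Z, Q > 0` (depending on the flow, `s`, `Λ`, `Λ'`)
with

  `K(x,t;y,s) ≤ Z (t − s)^{−m/2} exp(−d_s(z,y)²/(Q (t − s)))`

for all `t ∈ (s, T]`, `x, y, z ∈ M` with `∫ d_s(z,·)² dν_{x,t;s} ≤ H_m (t − s)`,
`H_m = (m − 1)π²/2 + 4` (the `H_m`-centre hypothesis in kernel form).

Proof (density/concentration argument, `τ = t − s`, `d = d_s(z, y)`):
* measure concentration at an `H_m`-centre (Bamler's Thm. 3.12,
  `heatKernelMeasure_real_setOf_le_edist_le`): `ν_{x,t;s}(B_s(y, r)) ≤ 2 e^{−d²/(32τ)}` once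
  `2(r + √(2H_mτ)) ≤ d` (`heatKernelMeasure_real_ball_le_of_far`);
* regularity in `y`: the interior Bernstein–Shi bound for the conjugate heat equation
  (`exists_conjugateHeat_mul_gradSq_le`) applied to `(w, r) ↦ K(x,t;w,r)` on `[s, s + τ/2]`
  together with the on-diagonal bound `K ≤ C (t − r)^{−m/2}` (`IsRicciFlow.exists_heatKernelFn_le`)
  gives `|∇_y K(x,t;·,s)| ≤ C_L τ^{−m/2}/√τ` (`IsRicciFlow.exists_sqrt_gradSq_heatKernelFn_le`);
* hence `K ≥ K(x,t;y,s) − L r` on `B_s(y, r)` (`abs_sub_le_mul_edist_of_sqrt_gradSq_le`) and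
  `(K(x,t;y,s) − L r) Vol_s(B_s(y,r)) ≤ ν_{x,t;s}(B_s(y,r))`
  (`sub_mul_le_heatKernelMeasure_real_ball`);
* `Vol_s(B_s(y, r)) ≥ c₀ rᵐ` for `r ≤ √(T − s)` (`exists_mul_pow_le_vol_ball`, compactness);
* the choice `r = √τ · e^{−d²/(64 m τ)}` (and the trivial bound `K ≤ C τ^{−m/2}` when
  `d ≤ 4(1 + √(2H_m))√τ`) yields the claim with `Q = 64 m`.

Everything is proved; no definitions, no named facts. What is NOT here: the uniform constants of
Bamler's Thm. 7.2 (which depend only on `m`, `R_min (t − s)` and the pointed Nash entropy), the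
existence of `H_m`-centres, non-compact flows.

## References

* R. H. Bamler, *Entropy and heat kernel bounds on a Ricci flow background*, arXiv:2008.07093
  (2020), §3.1 Thm. 3.12, §7.2, proof of Thm. 7.2, (7.14), (7.17)–(7.19). [Bamler2020Entropy]
* B. Chow et al., *The Ricci flow: techniques and applications. Part III: Geometric-analytic
  aspects*, AMS Math. Surveys and Monographs 163 (2010), Thm. 26.25 (Gaussian bounds for the
  heat kernel of an evolving metric on a closed manifold).
-/

noncomputable section

open Set Filter Function MeasureTheory Measure Module
open scoped Manifold ContDiff Topology ENNReal NNReal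

namespace Literature.Geometry.Riemannian

open Lorentzian Lorentzian.PseudoRiemannianMetric

/-! ### General model: volume of small balls, concentration, the gradient bound -/

section General

variable {m : ℕ} {H : Type*} [TopologicalSpace H]
  {I : ModelWithCorners ℝ (EuclideanSpace ℝ (Fin m)) H} [I.Boundaryless]
  {M : Type*} [TopologicalSpace M] [ChartedSpace H M] [IsManifold I ∞ M]
  [T2Space M] [CompactSpace M] [SecondCountableTopology M] [MeasurableSpace M] [BorelSpace M]

omit [T2Space M] [SecondCountableTopology M] in
/-- **Small distance balls of a Riemannian metric on a closed manifold have volume `≥ c rᵐ`**,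
real-valued form of `PseudoRiemannianMetric.exists_mul_pow_le_vol_ball` for the distance balls
`{w | d(p, w) < r}` of `PseudoRiemannianMetric.edist`: for every `R` there is `c > 0` with
`c rᵐ ≤ Vol_g {w | d(p, w) < r}` for all `p` and `0 < r ≤ R`. [folklore] -/
theorem exists_mul_pow_le_riemVolume_real_setOf_edist_lt [T3Space M]
    {g : PseudoRiemannianMetric I ∞ (EuclideanSpace ℝ (Fin m)) (TangentSpace I : M → Type _)}
    (hg : g.IsRiemannian) (R : ℝ) :
    ∃ c : ℝ, 0 < c ∧ ∀ (p : M) (r : ℝ), 0 < r → r ≤ R →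
      c * r ^ m ≤ g.riemVolume.real {w | g.edist hg p w < ENNReal.ofReal r} := by
  obtain ⟨c, hc, hvol⟩ := PseudoRiemannianMetric.exists_mul_pow_le_vol_ball (I := I) hg R
  refine ⟨c, hc, fun p r hr hrR ↦ ?_⟩
  have h1 := hvol p r hr hrR
  rw [finrank_euclideanSpace_fin] at h1
  have hset : g.ball p (ENNReal.ofReal r) = {w | g.edist hg p w < ENNReal.ofReal r} := by
    ext w
    simp only [PseudoRiemannianMetric.mem_ball, PseudoRiemannianMetric.riemEDist_eq hg,
      mem_setOf_eq]
  have hfin : g.riemVolume {w | g.edist hg p w < ENNReal.ofReal r} ≠ ⊤ :=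
    (lt_of_le_of_lt (measure_mono (subset_univ _)) g.riemVolume_univ_lt_top).ne
  have h2 : ENNReal.ofReal (c * r ^ m) ≤ g.riemVolume {w | g.edist hg p w < ENNReal.ofReal r} := by
    rw [← hset]
    exact h1
  rw [measureReal_def]
  exact (ENNReal.ofReal_le_iff_le_toReal hfin).1 h2

variable [PreconnectedSpace M]
  {h : ℝ → PseudoRiemannianMetric I ∞ (EuclideanSpace ℝ (Fin m)) (TangentSpace I : M → Type _)}
  {cov : ℝ → CovariantDerivative I (EuclideanSpace ℝ (Fin m)) (TangentSpace I : M → Type _)}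
  {a T : ℝ} (hflow : IsRicciFlow h cov (Icc a T)) (hh : IsContMDiffFamilyOn ∞ h univ)
  (hR : ∀ r, (h r).IsRiemannian)

/-- `ν_{x,t;s}(X) = ∫_X K(x,t;y,s) dg_s(y)` as a real number (the density property of the heat
kernel function). [cite: Bamler2020Entropy, §2.3, Def. 2.4] -/
private theorem heatKernelMeasure_real_eq_setIntegral_aux {t : ℝ} (ht : t ∈ Ioc a T) (x : M)
    {s : ℝ} (hs : s ∈ Ioo a t) {X : Set M} (hX : MeasurableSet X) :
    (heatKernelMeasure hh hR t x s).real X =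
      ∫ y in X, hflow.heatKernelFn hh hR t x (y, s) ∂(h s).riemVolume := by
  haveI : IsFiniteMeasure (h s).riemVolume := ⟨(h s).riemVolume_univ_lt_top⟩
  have hKc : Continuous fun y ↦ hflow.heatKernelFn hh hR t x (y, s) :=
    hflow.continuous_heatKernelFn_slice hh hR ht x hs
  have hK0 : ∀ y, 0 ≤ hflow.heatKernelFn hh hR t x (y, s) := fun y ↦
    (hflow.heatKernelFn_pos hh hR ht x ⟨mem_univ _, hs⟩).le
  have hint : Integrable (fun y ↦ hflow.heatKernelFn hh hR t x (y, s)) (h s).riemVolume :=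
    hKc.integrable_of_hasCompactSupport (HasCompactSupport.of_compactSpace _)
  rw [measureReal_def, hflow.heatKernelMeasure_eq_withDensity_heatKernelFn hh hR ht x hs,
    withDensity_apply _ hX, ← ofReal_integral_eq_lintegral_ofReal hint.integrableOn
      (ae_of_all _ hK0), ENNReal.toReal_ofReal (setIntegral_nonneg hX fun y _ ↦ hK0 y)]

include hflow in
/-- **Concentration of `ν_{x,t;s}` away from an `H_m`-centre, ball form** (Bamler 2020a,
Thm. 3.12 applied to a distance ball far from the centre): if `(z, s)` is an `H_m`-centre of
`(x, t)` (`∫ d_s(z,·)² dν_{x,t;s} ≤ H_m (t − s)`), `r ≥ 0` and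
`2 (r + √(2 H_m (t − s))) ≤ d_s(z, y)`, then
`ν_{x,t;s} {w | d_s(y, w) < r} ≤ 2 exp(−d_s(z,y)²/(32 (t − s)))` — the ball is contained in
`{w | d_s(z,y) − r ≤ d_s(z, w)}` and `d_s(z,y) − r − √(2H_m(t−s)) ≥ d_s(z,y)/2`.
[cite: Bamler2020Entropy, §3.1, Thm. 3.12; §7.2, (7.18)] -/
theorem IsRicciFlow.heatKernelMeasure_real_ball_le_of_far [T3Space M] {s t : ℝ} (has : a < s)
    (hst : s < t) (htT : t ≤ T) (x y z : M)
    (hz : ∫⁻ w, (h s).edist (hR s) z w ^ 2 ∂(heatKernelMeasure hh hR t x s) ≤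
      ENNReal.ofReal ((((m : ℝ) - 1) * Real.pi ^ 2 / 2 + 4) * (t - s)))
    {r : ℝ} (hr : 0 ≤ r)
    (hfar : 2 * (r + Real.sqrt (2 * ((((m : ℝ) - 1) * Real.pi ^ 2 / 2 + 4) * (t - s)))) ≤
      ((h s).edist (hR s) z y).toReal) :
    (heatKernelMeasure hh hR t x s).real {w | (h s).edist (hR s) y w < ENNReal.ofReal r} ≤
      2 * Real.exp (-((h s).edist (hR s) z y).toReal ^ 2 / (32 * (t - s))) := by
  set ν := heatKernelMeasure hh hR t x s with hν
  set d : ℝ := ((h s).edist (hR s) z y).toReal with hd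
  set ρ₀ : ℝ := Real.sqrt (2 * ((((m : ℝ) - 1) * Real.pi ^ 2 / 2 + 4) * (t - s))) with hρ₀
  have hτ0 : 0 < t - s := sub_pos.2 hst
  have hρ₀0 : 0 ≤ ρ₀ := Real.sqrt_nonneg _
  -- the ball is contained in the super-level set `{d - r ≤ d_s(z, ·)}`
  have hsub : {w | (h s).edist (hR s) y w < ENNReal.ofReal r} ⊆
      {w | ENNReal.ofReal (d - r) ≤ (h s).edist (hR s) z w} := by
    intro w hw
    rw [mem_setOf_eq] at hw ⊢
    have hyw : (h s).edist (hR s) y w ≠ ⊤ := PseudoRiemannianMetric.edist_ne_top (hR s) y w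
    have hzw : (h s).edist (hR s) z w ≠ ⊤ := PseudoRiemannianMetric.edist_ne_top (hR s) z w
    have htri : (h s).edist (hR s) z y ≤ (h s).edist (hR s) z w + (h s).edist (hR s) y w := by
      rw [PseudoRiemannianMetric.edist_comm (hR s) y w]
      exact PseudoRiemannianMetric.edist_triangle (hR s) z w y
    have h2 := ENNReal.toReal_mono (ENNReal.add_ne_top.2 ⟨hzw, hyw⟩) htri
    rw [ENNReal.toReal_add hzw hyw] at h2
    have h3 : ((h s).edist (hR s) y w).toReal < r := ENNReal.toReal_lt_of_lt_ofReal hw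
    refine (ENNReal.ofReal_le_iff_le_toReal hzw).2 ?_
    rw [hd]
    linarith
  have hconc := heatKernelMeasure_real_setOf_le_edist_le hflow hh hR has hst htT x z hz (d - r)
    (by linarith)
  have hge : d / 2 ≤ d - r - ρ₀ := by linarith
  have hd0 : 0 ≤ d := ENNReal.toReal_nonneg
  have hmax : max (d - r - ρ₀) 0 = d - r - ρ₀ := max_eq_left (by linarith)
  rw [hmax] at hconc
  calc ν.real {w | (h s).edist (hR s) y w < ENNReal.ofReal r}
      ≤ ν.real {w | ENNReal.ofReal (d - r) ≤ (h s).edist (hR s) z w} := measureReal_mono hsub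
    _ ≤ 2 * Real.exp (-(d - r - ρ₀) ^ 2 / (8 * (t - s))) := hconc
    _ ≤ 2 * Real.exp (-d ^ 2 / (32 * (t - s))) := by
      refine mul_le_mul_of_nonneg_left (Real.exp_le_exp.2 ?_) zero_le_two
      have hsq : (d / 2) ^ 2 ≤ (d - r - ρ₀) ^ 2 := pow_le_pow_left₀ (by linarith) hge 2
      rw [neg_div, neg_div, neg_le_neg_iff, div_le_div_iff₀ (by positivity) (by positivity)]
      nlinarith [hsq, hτ0]

/-- **Gradient bound for the heat kernel in its second space variable, a-priori form**: for a
Ricci flow on `[a, T]` of a `C^∞` family of Riemannian metrics on a closed connected manifold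
modelled on `ℝᵐ`, `m ≥ 3`, `a < s < T`, `|Rm| ≤ Λ` and `|∇R|² ≤ Λ'²` on `[s, T]`, there is
`C ≥ 0` (depending on the flow) with `|∇_y K(x,t;·,s)|_{h(s)} ≤ C (t − s)^{−m/2}/√(t − s)` for all
`t ∈ (s, T]`, `x, y` — the Bernstein–Shi interior estimate `exists_conjugateHeat_mul_gradSq_le`
for the conjugate heat solution `(w, r) ↦ K(x,t;w,r)` on `[s, (s+t)/2]`, where
`K ≤ C₁ ((t−s)/2)^{−m/2}` (`IsRicciFlow.exists_heatKernelFn_le`).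
[cite: Bamler2020Entropy, §7.2, proof of Thm. 7.2, (7.17)] -/
theorem IsRicciFlow.exists_sqrt_gradSq_heatKernelFn_le (hm : 3 ≤ m) {s : ℝ} (has : a < s)
    (hsT : s < T) {Λ Λ' : ℝ} (hΛ : 0 ≤ Λ) (hΛ' : 0 ≤ Λ')
    (hcurv : ∀ r ∈ Icc s T, CurvatureBoundedBy (h r) (cov r) Λ)
    (hdR : ∀ r ∈ Icc s T, ∀ y : M,
      (h r).gradSq (fun z ↦ (h r).scalarCurvatureWith (cov r) z) y ≤ Λ' ^ 2) :
    ∃ C : ℝ, 0 ≤ C ∧ ∀ ⦃t : ℝ⦄, s < t → t ≤ T → ∀ x w : M,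
      Real.sqrt ((h s).gradSq (fun y ↦ hflow.heatKernelFn hh hR t x (y, s)) w) ≤
        C * (t - s) ^ (-(m : ℝ) / 2) / Real.sqrt (t - s) := by
  have haT : a < T := has.trans hsT
  obtain ⟨C₁, hC₁, hK⟩ := hflow.exists_heatKernelFn_le hh hR haT hm
  obtain ⟨C₂, hC₂, hG⟩ := exists_conjugateHeat_mul_gradSq_le m (Λ₀ := Λ * (T - s))
    (Λ₁ := Λ' ^ 2 * (T - s) ^ 3) (mul_nonneg hΛ (by linarith)) (by positivity)
  refine ⟨Real.sqrt (2 * C₂) * C₁ * 2 ^ ((m : ℝ) / 2), by positivity, fun t hst htT x w ↦ ?_⟩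
  set τ := t - s with hτ
  have hτ0 : 0 < τ := sub_pos.2 hst
  set t₁ := s + τ / 2 with ht₁
  have hst₁ : s < t₁ := by linarith
  have ht₁t : t₁ < t := by linarith
  have ht : t ∈ Ioc a T := ⟨has.trans hst, htT⟩
  -- the conjugate heat solution `v r y = K(x,t;y,r)` on `[s, t₁]`
  set K : M × ℝ → ℝ := hflow.heatKernelFn hh hR t x with hKdef
  have hKs : ContMDiffOn (I.prod 𝓘(ℝ, ℝ)) 𝓘(ℝ, ℝ) ∞ K (univ ×ˢ Ioo a t) :=
    hflow.heatKernelFn_contMDiffOn hh hR ht x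
  have hKpde : ∀ p ∈ univ ×ˢ Ioo a t, deriv (fun s ↦ K (p.1, s)) p.2 =
      -(h p.2).laplaceBeltrami (fun y ↦ K (y, p.2)) p.1 +
        (h p.2).scalarCurvatureWith (cov p.2) p.1 * K p := fun p hp ↦
    hflow.deriv_heatKernelFn_time hh hR ht x hp
  have hsol : IsConjugateHeatSolutionOn h cov (Icc s t₁) fun r y ↦ K (y, r) :=
    isConjugateHeatSolutionOn_of_kernel hKs hKpde has hst₁ ht₁t
  -- the sup bound `|v| ≤ B = C₁ (τ/2)^{-m/2}` on `M × [s, t₁]`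
  set B : ℝ := C₁ * (τ / 2) ^ (-((m : ℝ) / 2)) with hB
  have hB0 : 0 ≤ B := mul_nonneg hC₁ (Real.rpow_nonneg (by positivity) _)
  have hvB : ∀ r ∈ Icc s t₁, ∀ y : M, |(fun r y ↦ K (y, r)) r y| ≤ B := by
    intro r hr y
    have hrt : r ∈ Ioo a t := ⟨has.trans_le hr.1, hr.2.trans_lt ht₁t⟩
    have hpos : 0 < K (y, r) := hflow.heatKernelFn_pos hh hR ht x ⟨mem_univ _, hrt⟩
    show |K (y, r)| ≤ B
    rw [abs_of_pos hpos]
    refine (hK t ht x r hrt y).trans (mul_le_mul_of_nonneg_left ?_ hC₁)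
    exact Real.rpow_le_rpow_of_nonpos (by positivity) (by linarith [hr.2])
      (neg_nonpos.2 (by positivity))
  have hflow' : IsRicciFlow h cov (Icc s t₁) :=
    hflow.mono (Icc_subset_Icc has.le (ht₁t.le.trans htT))
  have hIcc : Icc s t₁ ⊆ Icc s T := Icc_subset_Icc le_rfl (ht₁t.le.trans htT)
  have hΛT : Λ * (t₁ - s) ≤ Λ * (T - s) := mul_le_mul_of_nonneg_left (by linarith) hΛ
  have hΛ'T : Λ' ^ 2 * (t₁ - s) ^ 3 ≤ Λ' ^ 2 * (T - s) ^ 3 :=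
    mul_le_mul_of_nonneg_left (pow_le_pow_left₀ (by linarith) (by linarith) 3) (sq_nonneg _)
  have hgrad := hG hst₁ hflow' (fun r _ ↦ hR r) hΛ hΛ' hΛT hΛ'T (fun r hr ↦ hcurv r (hIcc hr))
    (fun r hr ↦ hdR r (hIcc hr)) hsol hvB w
  -- `(τ/2) |∇K|² ≤ C₂ B²`
  have ht₁s : t₁ - s = τ / 2 := by rw [ht₁]; ring
  have hgrad' : τ / 2 * (h s).gradSq (fun y ↦ hflow.heatKernelFn hh hR t x (y, s)) w ≤
      C₂ * B ^ 2 := by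
    rw [← ht₁s]
    exact hgrad
  have hG1 : (h s).gradSq (fun y ↦ hflow.heatKernelFn hh hR t x (y, s)) w ≤
      2 * C₂ * B ^ 2 / τ := by
    rw [le_div_iff₀ hτ0]
    linarith
  -- `B = C₁ 2^{m/2} τ^{-m/2}`
  have hpow : (τ / 2) ^ (-((m : ℝ) / 2)) = 2 ^ ((m : ℝ) / 2) * τ ^ (-(m : ℝ) / 2) := by
    rw [Real.div_rpow hτ0.le zero_le_two, neg_div, Real.rpow_neg zero_le_two, div_inv_eq_mul,
      mul_comm]
  have hL : Real.sqrt (2 * C₂) * C₁ * 2 ^ ((m : ℝ) / 2) * τ ^ (-(m : ℝ) / 2) / Real.sqrt τ =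
      Real.sqrt (2 * C₂) * B / Real.sqrt τ := by
    rw [hB, hpow]
    ring
  rw [hL, Real.sqrt_le_iff]
  refine ⟨by positivity, ?_⟩
  rw [div_pow, mul_pow, Real.sq_sqrt (by positivity), Real.sq_sqrt hτ0.le]
  exact hG1

end General

/-! ### Self model: the Lipschitz step and the Gaussian bound -/

section KernelSelf

variable {m : ℕ} {M : Type*} [TopologicalSpace M] [ChartedSpace (EuclideanSpace ℝ (Fin m)) M]
  [IsManifold 𝓘(ℝ, EuclideanSpace ℝ (Fin m)) ∞ M] [T2Space M] [CompactSpace M]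
  [SecondCountableTopology M] [MeasurableSpace M] [BorelSpace M] [ConnectedSpace M] [T3Space M]
  {h : ℝ → PseudoRiemannianMetric 𝓘(ℝ, EuclideanSpace ℝ (Fin m)) ∞ (EuclideanSpace ℝ (Fin m))
    (TangentSpace 𝓘(ℝ, EuclideanSpace ℝ (Fin m)) : M → Type _)}
  {cov : ℝ → CovariantDerivative 𝓘(ℝ, EuclideanSpace ℝ (Fin m)) (EuclideanSpace ℝ (Fin m))
    (TangentSpace 𝓘(ℝ, EuclideanSpace ℝ (Fin m)) : M → Type _)}
  {a T : ℝ} (hflow : IsRicciFlow h cov (Icc a T)) (hh : IsContMDiffFamilyOn ∞ h univ)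
  (hR : ∀ r, (h r).IsRiemannian)

/-- **Lower bound of `ν_{x,t;s}` on a ball from a gradient bound of the kernel** (the density
step of Bamler 2020a, §7.2, (7.18)–(7.19)): if `|∇_y K(x,t;·,s)|_{h(s)} ≤ L` on `M`, then on the
ball `B = {w | d_s(y, w) < r}` one has `K(x,t;w,s) ≥ K(x,t;y,s) − L r` (integration along
minimising geodesics, `abs_sub_le_mul_edist_of_sqrt_gradSq_le`), hence
`(K(x,t;y,s) − L r) Vol_s(B) ≤ ∫_B K(x,t;·,s) dg_s = ν_{x,t;s}(B)`.
[cite: Bamler2020Entropy, §7.2, proof of Thm. 7.2, (7.18)–(7.19)] -/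
theorem sub_mul_le_heatKernelMeasure_real_ball {s t : ℝ} (has : a < s) (hst : s < t)
    (htT : t ≤ T) (x y : M) {L : ℝ} (r : ℝ) (hL : 0 ≤ L)
    (hgrad : ∀ w, Real.sqrt ((h s).gradSq (fun y ↦ hflow.heatKernelFn hh hR t x (y, s)) w) ≤ L) :
    (hflow.heatKernelFn hh hR t x (y, s) - L * r) *
        (h s).riemVolume.real {w | (h s).edist (hR s) y w < ENNReal.ofReal r} ≤
      (heatKernelMeasure hh hR t x s).real {w | (h s).edist (hR s) y w < ENNReal.ofReal r} := by
  set Bset : Set M := {w | (h s).edist (hR s) y w < ENNReal.ofReal r} with hBset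
  have ht : t ∈ Ioc a T := ⟨has.trans hst, htT⟩
  have hs : s ∈ Ioo a t := ⟨has, hst⟩
  have hBm : MeasurableSet Bset :=
    (PseudoRiemannianMetric.isOpen_setOf_edist_lt (hR s) y _).measurableSet
  haveI : IsFiniteMeasure (h s).riemVolume := ⟨(h s).riemVolume_univ_lt_top⟩
  set K : M → ℝ := fun w ↦ hflow.heatKernelFn hh hR t x (w, s) with hKdef
  have hKc : Continuous K := hflow.continuous_heatKernelFn_slice hh hR ht x hs
  have hKs : ContMDiff 𝓘(ℝ, EuclideanSpace ℝ (Fin m)) 𝓘(ℝ, ℝ) ∞ K :=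
    (hflow.heatKernelFn_contMDiffOn hh hR ht x).comp_contMDiff
      (contMDiff_id.prodMk contMDiff_const) fun w ↦ ⟨mem_univ _, hs⟩
  -- the Lipschitz bound: on the ball `K w ≥ K y - L r`
  have hlip : ∀ w ∈ Bset, K y - L * r ≤ K w := by
    intro w hw
    have hfin : (h s).edist (hR s) y w ≠ ⊤ := PseudoRiemannianMetric.edist_ne_top (hR s) y w
    set r₁ : ℝ := ((h s).edist (hR s) y w).toReal + 1 with hr₁
    have hr₁0 : 0 < r₁ := by positivity
    have h1 : (h s).edist (hR s) y y < ENNReal.ofReal r₁ := by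
      rw [PseudoRiemannianMetric.edist_self]
      exact ENNReal.ofReal_pos.2 hr₁0
    have h2 : (h s).edist (hR s) y w < ENNReal.ofReal r₁ :=
      (ENNReal.lt_ofReal_iff_toReal_lt hfin).2 (by linarith)
    obtain ⟨hle, -⟩ := abs_sub_le_mul_edist_of_sqrt_gradSq_le (h s) (hR s) hKs y hL
      (fun w' _ ↦ hgrad w') h1 h2
    have hdr : ((h s).edist (hR s) y w).toReal < r := ENNReal.toReal_lt_of_lt_ofReal hw
    have h3 := (abs_sub_le_iff.1 hle).1
    have h4 : L * ((h s).edist (hR s) y w).toReal ≤ L * r := mul_le_mul_of_nonneg_left hdr.le hL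
    linarith
  have hint : IntegrableOn K Bset (h s).riemVolume :=
    (hKc.integrable_of_hasCompactSupport (HasCompactSupport.of_compactSpace _)).integrableOn
  calc (K y - L * r) * (h s).riemVolume.real Bset
      = ∫ _ in Bset, (K y - L * r) ∂(h s).riemVolume := by
        rw [setIntegral_const, smul_eq_mul, mul_comm]
    _ ≤ ∫ w in Bset, K w ∂(h s).riemVolume := setIntegral_mono_on integrableOn_const hint hBm hlip
    _ = (heatKernelMeasure hh hR t x s).real Bset :=
        (heatKernelMeasure_real_eq_setIntegral_aux hflow hh hR ht x hs hBm).symm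

/-- **The a-priori Gaussian bound for the heat kernel at an `H_m`-centre** (Bamler 2020a, §7.2,
proof of Thm. 7.2, (7.17)–(7.19) and (7.14) with flow-dependent constants): for a Ricci flow
`(h, cov)` on `[a, T]` of a `C^∞` family of Riemannian metrics on a closed connected manifold
modelled on `ℝᵐ`, `m ≥ 3`, `a < s < T`, `|Rm| ≤ Λ` and `|∇R|² ≤ Λ'²` on `[s, T]`, there are
`Z, Q > 0` such that for all `t ∈ (s, T]`, `x, y, z ∈ M` with
`∫ d_s(z, ·)² dν_{x,t;s} ≤ H_m (t − s)`, `H_m = (m − 1)π²/2 + 4`,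

  `K(x,t;y,s) ≤ Z (t − s)^{−m/2} exp(−d_s(z, y)²/(Q (t − s)))`.

Proof: measure concentration at the centre (Thm. 3.12), the interior gradient bound for the
conjugate heat equation, the Lipschitz lower bound of `K` on a ball `B_s(y, r)`, the lower volume
bound of small balls, and the choice `r = √(t−s) exp(−d²/(64 m (t−s)))`; `Q = 64 m`.
[cite: Bamler2020Entropy, §7.2, proof of Thm. 7.2, (7.17)–(7.19)] -/
theorem exists_apriori_heatKernelFn_le_gaussian (hm : 3 ≤ m) {s : ℝ} (has : a < s) (hsT : s < T)
    {Λ Λ' : ℝ} (hΛ : 0 ≤ Λ) (hΛ' : 0 ≤ Λ')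
    (hcurv : ∀ r ∈ Icc s T, CurvatureBoundedBy (h r) (cov r) Λ)
    (hdR : ∀ r ∈ Icc s T, ∀ y : M,
      (h r).gradSq (fun z ↦ (h r).scalarCurvatureWith (cov r) z) y ≤ Λ' ^ 2) :
    ∃ Z Q : ℝ, 0 < Z ∧ 0 < Q ∧ ∀ {t : ℝ}, s < t → t ≤ T → ∀ x y z : M,
      ∫⁻ w, (h s).edist (hR s) z w ^ 2 ∂(heatKernelMeasure hh hR t x s) ≤
        ENNReal.ofReal ((((m : ℝ) - 1) * Real.pi ^ 2 / 2 + 4) * (t - s)) →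
      hflow.heatKernelFn hh hR t x (y, s) ≤
        Z * (t - s) ^ (-(m : ℝ) / 2) *
          Real.exp (-((h s).edist (hR s) z y).toReal ^ 2 / (Q * (t - s))) := by
  have haT : a < T := has.trans hsT
  have hm1 : (1 : ℝ) ≤ m := by exact_mod_cast (le_trans (by norm_num) hm)
  have hm0 : (0 : ℝ) < m := by linarith
  have hmne : m ≠ 0 := by omega
  -- the constants
  obtain ⟨C₁, hC₁, hK⟩ := hflow.exists_heatKernelFn_le hh hR haT hm
  obtain ⟨C_L, hC_L, hgrad⟩ :=
    hflow.exists_sqrt_gradSq_heatKernelFn_le hh hR hm has hsT hΛ hΛ' hcurv hdR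
  obtain ⟨c₀, hc₀, hvol⟩ :=
    exists_mul_pow_le_riemVolume_real_setOf_edist_lt (I := 𝓘(ℝ, EuclideanSpace ℝ (Fin m)))
      (hR s) (Real.sqrt (T - s))
  set Hm : ℝ := ((m : ℝ) - 1) * Real.pi ^ 2 / 2 + 4 with hHm
  have hHm0 : 0 ≤ Hm := by
    have : (0 : ℝ) ≤ ((m : ℝ) - 1) * Real.pi ^ 2 / 2 := by
      have h1 : (0 : ℝ) ≤ (m : ℝ) - 1 := by linarith
      positivity
    linarith
  set Q : ℝ := 64 * m with hQ
  have hQ0 : 0 < Q := by positivity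
  set A : ℝ := 16 * (1 + Real.sqrt (2 * Hm)) ^ 2 / Q with hA
  set Z : ℝ := C₁ * Real.exp A + C_L + 2 / c₀ with hZ
  have hZ0 : 0 < Z := by positivity
  refine ⟨Z, Q, hZ0, hQ0, fun {t} hst htT x y z hz ↦ ?_⟩
  -- basic quantities: `τ = t - s`, `d = d_s(z, y)`, `P = τ^{m/2}`, `E = exp(-d²/(Qτ))`
  set τ := t - s with hτ
  have hτ0 : 0 < τ := sub_pos.2 hst
  have hsqτ0 : 0 < Real.sqrt τ := Real.sqrt_pos.2 hτ0
  set d : ℝ := ((h s).edist (hR s) z y).toReal with hd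
  have hd0 : 0 ≤ d := ENNReal.toReal_nonneg
  set P : ℝ := τ ^ ((m : ℝ) / 2) with hP
  have hP0 : 0 < P := Real.rpow_pos_of_pos hτ0 _
  have hPinv : τ ^ (-(m : ℝ) / 2) = P⁻¹ := by rw [neg_div, Real.rpow_neg hτ0.le]
  set E : ℝ := Real.exp (-d ^ 2 / (Q * τ)) with hE
  have hE0 : 0 < E := Real.exp_pos _
  have hE1 : E ≤ 1 := by
    rw [hE, Real.exp_le_one_iff, neg_div]
    exact neg_nonpos.2 (by positivity)
  rw [hPinv]
  have ht : t ∈ Ioc a T := ⟨has.trans hst, htT⟩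
  have hs' : s ∈ Ioo a t := ⟨has, hst⟩
  -- the trivial bound `K ≤ C₁ τ^{-m/2}`
  have hKy : hflow.heatKernelFn hh hR t x (y, s) ≤ C₁ * P⁻¹ := by
    have h1 := hK t ht x s hs' y
    rwa [Real.rpow_neg hτ0.le] at h1
  rcases le_or_gt d (4 * (1 + Real.sqrt (2 * Hm)) * Real.sqrt τ) with hnear | hfar
  · -- case (i): `d ≤ 4(1 + √(2 H_m)) √τ`, the on-diagonal bound suffices
    have hd2 : d ^ 2 ≤ 16 * (1 + Real.sqrt (2 * Hm)) ^ 2 * τ := by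
      calc d ^ 2 ≤ (4 * (1 + Real.sqrt (2 * Hm)) * Real.sqrt τ) ^ 2 :=
            pow_le_pow_left₀ hd0 hnear 2
        _ = 16 * (1 + Real.sqrt (2 * Hm)) ^ 2 * Real.sqrt τ ^ 2 := by ring
        _ = 16 * (1 + Real.sqrt (2 * Hm)) ^ 2 * τ := by rw [Real.sq_sqrt hτ0.le]
    have hA' : d ^ 2 / (Q * τ) ≤ A := by
      rw [hA, div_le_div_iff₀ (by positivity) hQ0]
      have := mul_le_mul_of_nonneg_right hd2 hQ0.le
      linarith
    have h1 : 1 ≤ Real.exp A * E := by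
      rw [hE, ← Real.exp_add]
      refine Real.one_le_exp ?_
      rw [neg_div]
      linarith
    calc hflow.heatKernelFn hh hR t x (y, s) ≤ C₁ * P⁻¹ := hKy
      _ ≤ C₁ * P⁻¹ * (Real.exp A * E) := le_mul_of_one_le_right (by positivity) h1
      _ = C₁ * Real.exp A * P⁻¹ * E := by ring
      _ ≤ Z * P⁻¹ * E := by
        have h2 : C₁ * Real.exp A ≤ Z := by rw [hZ]; linarith [div_pos two_pos hc₀]
        gcongr
  · -- case (ii): `d > 4(1 + √(2 H_m)) √τ`; the radius `r = √τ E`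
    set r : ℝ := Real.sqrt τ * E with hr
    have hr0 : 0 < r := mul_pos hsqτ0 hE0
    have hrle : r ≤ Real.sqrt τ := mul_le_of_le_one_right hsqτ0.le hE1
    have hrR : r ≤ Real.sqrt (T - s) := hrle.trans (Real.sqrt_le_sqrt (by linarith))
    -- volume from below
    have hV := hvol y r hr0 hrR
    set Vr : ℝ := (h s).riemVolume.real {w | (h s).edist (hR s) y w < ENNReal.ofReal r} with hVr
    have hVr0 : 0 < Vr := lt_of_lt_of_le (by positivity) hV
    -- the Lipschitz lower bound on the ball
    set L : ℝ := C_L * P⁻¹ / Real.sqrt τ with hL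
    have hL0 : 0 ≤ L := by positivity
    have hgradL : ∀ w, Real.sqrt ((h s).gradSq (fun y ↦ hflow.heatKernelFn hh hR t x (y, s)) w)
        ≤ L := by
      intro w
      have h1 := hgrad hst htT x w
      rwa [hPinv] at h1
    have h2 := sub_mul_le_heatKernelMeasure_real_ball hflow hh hR has hst htT x y r hL0 hgradL
    -- concentration
    have hρ : Real.sqrt (2 * (Hm * τ)) = Real.sqrt (2 * Hm) * Real.sqrt τ := by
      rw [← mul_assoc, Real.sqrt_mul (by positivity)]
    have hfar' : 2 * (r + Real.sqrt (2 * (Hm * τ))) ≤ d := by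
      rw [hρ]
      have h4 : 4 * (1 + Real.sqrt (2 * Hm)) * Real.sqrt τ =
          4 * Real.sqrt τ + 4 * (Real.sqrt (2 * Hm) * Real.sqrt τ) := by ring
      rw [h4] at hfar
      have h5 : 0 ≤ Real.sqrt (2 * Hm) * Real.sqrt τ := by positivity
      linarith
    have h3 := hflow.heatKernelMeasure_real_ball_le_of_far hh hR has hst htT x y z hz hr0.le hfar'
    -- the identities `exp(-d²/(32τ)) = E^{2m}`, `r^m = P E^m`
    have hexp : Real.exp (-d ^ 2 / (32 * τ)) = E ^ (2 * m) := by
      rw [hE, ← Real.exp_nat_mul]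
      congr 1
      push_cast
      rw [hQ]
      field_simp
      ring
    have hsqm : Real.sqrt τ ^ m = P := by
      rw [hP, Real.sqrt_eq_rpow, ← Real.rpow_natCast, ← Real.rpow_mul hτ0.le]
      congr 1
      ring
    have hrm : r ^ m = P * E ^ m := by rw [hr, mul_pow, hsqm]
    have hEm0 : 0 < E ^ m := pow_pos hE0 m
    -- `K - L r ≤ ν(B)/Vol(B) ≤ 2 E^{2m}/(c₀ r^m) = (2/c₀) P⁻¹ E^m`
    have h4 : hflow.heatKernelFn hh hR t x (y, s) - L * r ≤ 2 * E ^ (2 * m) / Vr := by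
      rw [le_div_iff₀ hVr0, ← hexp]
      exact h2.trans h3
    have h5 : 2 * E ^ (2 * m) / Vr ≤ 2 * E ^ (2 * m) / (c₀ * r ^ m) :=
      div_le_div_of_nonneg_left (by positivity) (by positivity) hV
    have hE2 : E ^ (2 * m) = E ^ m * E ^ m := by rw [two_mul, pow_add]
    have h6 : 2 * E ^ (2 * m) / (c₀ * r ^ m) = 2 / c₀ * P⁻¹ * E ^ m := by
      rw [hE2, hrm]
      field_simp
    have h7 : E ^ m ≤ E := pow_le_of_le_one hE0.le hE1 hmne
    have hLr : L * r = C_L * P⁻¹ * E := by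
      rw [hL, hr]
      field_simp
    calc hflow.heatKernelFn hh hR t x (y, s)
        = (hflow.heatKernelFn hh hR t x (y, s) - L * r) + L * r := by ring
      _ ≤ 2 / c₀ * P⁻¹ * E ^ m + L * r := add_le_add (h4.trans (h5.trans_eq h6)) le_rfl
      _ = 2 / c₀ * P⁻¹ * E ^ m + C_L * P⁻¹ * E := by rw [hLr]
      _ ≤ 2 / c₀ * P⁻¹ * E + C_L * P⁻¹ * E := by gcongr
      _ = (C_L + 2 / c₀) * P⁻¹ * E := by ring
      _ ≤ Z * P⁻¹ * E := by
        have h8 : C_L + 2 / c₀ ≤ Z := by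
          rw [hZ]
          have : 0 ≤ C₁ * Real.exp A := by positivity
          linarith
        gcongr

end KernelSelf

end Literature.Geometry.Riemannian

end
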